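import Mathlib
import HarnessLib
import Summits.HubbardSuperconductivity.HubbardSuperconductivity.Theorems.KLProgrammeC4aPPKernelShiftNumerator

/-!
# Route `KLProgramme` — crux C4a, S3 brick (B4) «(B4)-UMK1», «(M1)-TRUE-KERNEL» adaptation (Ω), part 2: the shifted numerator's SIZES — uniform gradient
# `(6B₁+5/2)/Λ`, value `‖N_Ω(e,u)‖ ≤ 4‖e+u−iΩ‖/Λ`, and on the far region `Λ < u`: `‖∂ᵤN_Ω − (β/4)sech²(βu/2)‖ ≤ Λ/u²` (the full-orbit cancellation is Ω-independent)

Cell `gate-hubbard-kl`, seat hubbard-kl-k3c3-p1 (g15; row «δμ-flow with klAngularMean constant piece»).  Continuation of `…C4aPPKernelShiftNumerator` (stub (C) of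
stmt-HubbardSuperconductivity-20437; note `M1-TRUE-KERNEL.md` §6).  The Ω-twins of `…TrueNumeratorFar` / `…TrueFlatnessShape` §1:
* §1 complex one-line majorants: `norm_uvWeightFnD1_mul_resolvent_self_le` (`‖W′(ω,u)·r(ω,u)‖ ≤ 4B₁/(ω²+Λ²)`), `norm_uvSymbolFnXi_le_two_div` (`‖Ψ̂‖ ≤ 2/Λ`),
  `norm_uvWeightFn_mul_resolventD1_le` (`‖W(ω,u)·r′(ω,u)‖ ≤ 5/(ω²+Λ²)`), `norm_ppShiftSummandDu_le_unif` (`≤ (12B₁+5)/((Ω−ωₙ)²+Λ²)`), and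
  **`norm_ppShiftNumeratorDu_le_unif`**: `‖∂ᵤN_Ω(e,u)‖ ≤ (6B₁+5/2)/Λ` for all levels (hence the same for `∂ₑ`);
* §2 **`norm_ppShiftNumerator_le`**: `‖N_Ω(e,u)‖ ≤ 4‖e+u−iΩ‖/Λ` (no mean-value step needed: the product form is summable with that constant);
* §3 far region `Λ < u`: `ppShiftNumeratorDu_of_far` (`∂ᵤN_Ω = (1/β)Σ W(ωₙ,e)·r′(Ω−ωₙ,u)`), `tsum_int_resolventD1_eq` (`(1/β)Σ_{n∈ℤ} r′(ωₙ,u) = (β/4)sech²(βu/2)`: real part =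
  the two-sided Lorentzian-derivative sum, imaginary part odd), **`norm_ppShiftNumeratorDu_far_sub_le`** (`‖∂ᵤN_Ω − (β/4)sech²(βu/2)‖ ≤ Λ/u²` for every `e`, via the
  bosonic re-indexing `Σ g(Ω−ωₙ) = Σ g(ωₙ)` of `Literature…tsum_int_matsubara_shift` and the defect majorant `1 − W(ωₙ,e) ≤ 2Λ²/(ωₙ²+Λ²)`).
Pure real/complex analysis; nothing asserts (C), K3 or superconductivity.
References: BGM 2006 §2.1 (2.3), §2.4 [cite: BenfattoGiulianiMastropietro2006]; Salmhofer 1999 §4.2.5 [cite: Salmhofer1999].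
-/

noncomputable section

namespace Summit.HubbardSuperconductivity.HubbardSuperconductivity.Theorems.C4a

set_option linter.dupNamespace false -- summit = problem name (single-conjunct summit), D-0017

open Real Filter Set Complex
open scoped Topology
open Literature.MathematicalPhysics.QuantumLattice Literature.Analysis.SpecialFunctions

/-! ## §1 One-line complex majorants and the uniform gradient -/

/-- `‖W′(ω,u)·r(ω,u)‖ ≤ 4B₁/(ω² + Λ²)`: the cutoff derivative's own factor `2u/Λ²` against `‖r(ω,u)‖ ≤ 1/|u|`-free form `|u|·‖r‖ ≤ 1`, supported on the shell.
[cite: Salmhofer1999, §4.2.5 (4.71)] -/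
theorem norm_uvWeightFnD1_mul_resolvent_self_le {B₁ : ℝ} (hB₁ : ∀ x, |deriv salmhoferCutoff x| ≤ B₁) {Λ : ℝ} (hΛ : 0 < Λ) {ω : ℝ} (hω : ω ≠ 0) (u : ℝ) :
    ‖((uvWeightFnD1 Λ ω u : ℝ) : ℂ) * resolventFnXi 1 0 ω u‖ ≤ 4 * B₁ / (ω ^ 2 + Λ ^ 2) := by
  have hB0 := salmhoferB₁_nonneg hB₁
  by_cases h : Λ ^ 2 < u ^ 2 + ω ^ 2
  · rw [(uvWeightFn_eq_one_of_gt hΛ h).2.1]; simp; positivity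
  · have hωΛ : ω ^ 2 ≤ Λ ^ 2 := by nlinarith [not_lt.1 h, sq_nonneg u]
    have hden_ge : |u| ≤ ‖-I * ((ω + 0 : ℝ) : ℂ) + (u : ℂ)‖ := by
      have h1 := Complex.abs_re_le_norm (-I * ((ω + 0 : ℝ) : ℂ) + (u : ℂ))
      simpa using h1
    have hden_pos : 0 < ‖-I * ((ω + 0 : ℝ) : ℂ) + (u : ℂ)‖ := (abs_pos.2 hω).trans_le (abs_le_norm_uvDen u ω)
    rw [norm_mul, Complex.norm_real, Real.norm_eq_abs, norm_resolventFnXi zero_le_one]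
    -- `|W′| = |χ′|·2|u|/Λ²`
    have hW : |uvWeightFnD1 Λ ω u| ≤ B₁ * (2 * |u| / Λ ^ 2) := by
      unfold uvWeightFnD1
      rw [abs_mul, abs_div, abs_mul, abs_of_pos (by norm_num : (0 : ℝ) < 2), abs_of_pos (pow_pos hΛ 2)]
      exact mul_le_mul_of_nonneg_right (hB₁ _) (by positivity)
    have hq : |u| * (1 / ‖-I * ((ω + 0 : ℝ) : ℂ) + (u : ℂ)‖) ≤ 1 := by
      rw [mul_one_div, div_le_one hden_pos]; exact hden_ge
    have h2 : 2 / Λ ^ 2 ≤ 4 / (ω ^ 2 + Λ ^ 2) := by rw [div_le_div_iff₀ (by positivity) (by positivity)]; nlinarith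
    calc |uvWeightFnD1 Λ ω u| * (1 / ‖-I * ((ω + 0 : ℝ) : ℂ) + (u : ℂ)‖)
        ≤ B₁ * (2 * |u| / Λ ^ 2) * (1 / ‖-I * ((ω + 0 : ℝ) : ℂ) + (u : ℂ)‖) := mul_le_mul_of_nonneg_right hW (by positivity)
      _ = B₁ * (2 / Λ ^ 2) * (|u| * (1 / ‖-I * ((ω + 0 : ℝ) : ℂ) + (u : ℂ)‖)) := by ring
      _ ≤ B₁ * (2 / Λ ^ 2) * 1 := mul_le_mul_of_nonneg_left hq (by positivity)
      _ ≤ B₁ * (4 / (ω ^ 2 + Λ ^ 2)) := by rw [mul_one]; exact mul_le_mul_of_nonneg_left h2 hB0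
      _ = 4 * B₁ / (ω ^ 2 + Λ ^ 2) := by ring

/-- `‖Ψ̂(ω,e)‖ = ‖W(ω,e)/(−iω+e)‖ ≤ 2/Λ`. [cite: Salmhofer1999, §4.2.5 (4.71)] -/
theorem norm_uvSymbolFnXi_le_two_div {Λ : ℝ} (hΛ : 0 < Λ) (ω e : ℝ) : ‖uvSymbolFnXi 1 Λ ω e‖ ≤ 2 / Λ := by
  rw [← uvSymbolFn_eq_uvSymbolFnXi]
  refine (norm_uvSymbolFn_le hΛ zero_le_one _).trans ?_
  have : Λ / 2 ≤ max |ω| (Λ / 2) := le_max_right _ _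
  rw [div_le_div_iff₀ (lt_max_of_lt_right (by positivity)) hΛ]
  linarith

/-- `‖W(ω,u)·r′(ω,u)‖ ≤ 5/(ω² + Λ²)`: where `W ≠ 0`, `ω² + u² ≥ Λ²/4`. [cite: Salmhofer1999, §4.2.5 (4.71)] -/
theorem norm_uvWeightFn_mul_resolventD1_le {Λ : ℝ} (hΛ : 0 < Λ) {ω : ℝ} (hω : ω ≠ 0) (u : ℝ) :
    ‖((uvWeightFn Λ ω u : ℝ) : ℂ) * resolventFnXiD1 1 0 ω u‖ ≤ 5 / (ω ^ 2 + Λ ^ 2) := by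
  by_cases hW : uvWeightFn Λ ω u = 0
  · rw [hW]; simp; positivity
  · have hs : Λ ^ 2 / 4 ≤ u ^ 2 + ω ^ 2 := sq_add_sq_ge_of_uvWeightFn_ne_zero hΛ hW
    rw [norm_mul, Complex.norm_real, Real.norm_eq_abs, norm_resolventFnXiD1 zero_le_one, norm_sq_uvDen]
    have h1 : |uvWeightFn Λ ω u| ≤ 1 := abs_uvWeightFn_le_one _ _ _
    have hpos : 0 < ω ^ 2 + u ^ 2 := by positivity
    have h2 : 1 / (ω ^ 2 + u ^ 2) ≤ 5 / (ω ^ 2 + Λ ^ 2) := by rw [div_le_div_iff₀ hpos (by positivity)]; nlinarith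
    calc |uvWeightFn Λ ω u| * (1 / (ω ^ 2 + u ^ 2)) ≤ 1 * (5 / (ω ^ 2 + Λ ^ 2)) := mul_le_mul h1 h2 (by positivity) zero_le_one
      _ = 5 / (ω ^ 2 + Λ ^ 2) := one_mul _

/-- **Uniform per-summand bound**: `‖ppShiftSummandDu n‖ ≤ (12B₁ + 5)/((Ω−ωₙ)² + Λ²)` (temperature-free). [cite: BenfattoGiulianiMastropietro2006, §2.4 (2.36)] -/
theorem norm_ppShiftSummandDu_le_unif {β Λ : ℝ} (hβ : 0 < β) (hΛ : 0 < Λ) {B₁ : ℝ} (hB₁ : ∀ x, |deriv salmhoferCutoff x| ≤ B₁) (m : ℤ) (e u : ℝ) (n : ℤ) :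
    ‖ppShiftSummandDu β Λ m e u n‖ ≤ (12 * B₁ + 5) / ((ppBose β m - ppFreqZ β n) ^ 2 + Λ ^ 2) := by
  have hB0 := salmhoferB₁_nonneg hB₁
  set ω' : ℝ := ppBose β m - ppFreqZ β n with hω'
  have hω'ne : ω' ≠ 0 := by rw [hω', ppBose_sub_ppFreqZ]; exact ppFreqZ_ne_zero hβ _
  have h1 := norm_uvWeightFnD1_mul_resolvent_self_le hB₁ hΛ hω'ne u
  have h2 : ‖uvSymbolFnXi 1 Λ (ppFreqZ β n) e‖ ≤ 2 / Λ := norm_uvSymbolFnXi_le_two_div hΛ _ _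
  have h3 : ‖((uvWeightFnD1 Λ ω' u : ℝ) : ℂ)‖ ≤ 2 * B₁ / Λ * (2 * Λ ^ 2 / (ω' ^ 2 + Λ ^ 2)) := by
    rw [Complex.norm_real, Real.norm_eq_abs]; exact abs_uvWeightFnD1_le_shell hB₁ hΛ ω' u
  have h4 := norm_uvWeightFn_mul_resolventD1_le hΛ hω'ne u
  have hWe : ‖((uvWeightFn Λ (ppFreqZ β n) e : ℝ) : ℂ)‖ ≤ 1 := by
    rw [Complex.norm_real, Real.norm_eq_abs]; exact abs_uvWeightFn_le_one _ _ _
  -- regroup: W_e·(W′·r_u) + Ψ̂_e·W′ + W_e·(W·r′)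
  have hsplit : ppShiftSummandDu β Λ m e u n =
      ((uvWeightFn Λ (ppFreqZ β n) e : ℝ) : ℂ) * (((uvWeightFnD1 Λ ω' u : ℝ) : ℂ) * resolventFnXi 1 0 ω' u) +
      uvSymbolFnXi 1 Λ (ppFreqZ β n) e * ((uvWeightFnD1 Λ ω' u : ℝ) : ℂ) +
      ((uvWeightFn Λ (ppFreqZ β n) e : ℝ) : ℂ) * (((uvWeightFn Λ ω' u : ℝ) : ℂ) * resolventFnXiD1 1 0 ω' u) := by
    unfold ppShiftSummandDu uvSymbolFnXi; rw [← hω']; ring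
  rw [hsplit]
  have hp1 : ‖((uvWeightFn Λ (ppFreqZ β n) e : ℝ) : ℂ) * (((uvWeightFnD1 Λ ω' u : ℝ) : ℂ) * resolventFnXi 1 0 ω' u)‖ ≤ 1 * (4 * B₁ / (ω' ^ 2 + Λ ^ 2)) := by
    rw [norm_mul]; exact mul_le_mul hWe h1 (norm_nonneg _) zero_le_one
  have hp2 : ‖uvSymbolFnXi 1 Λ (ppFreqZ β n) e * ((uvWeightFnD1 Λ ω' u : ℝ) : ℂ)‖ ≤ 2 / Λ * (2 * B₁ / Λ * (2 * Λ ^ 2 / (ω' ^ 2 + Λ ^ 2))) := by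
    rw [norm_mul]; exact mul_le_mul h2 h3 (norm_nonneg _) (by positivity)
  have hp3 : ‖((uvWeightFn Λ (ppFreqZ β n) e : ℝ) : ℂ) * (((uvWeightFn Λ ω' u : ℝ) : ℂ) * resolventFnXiD1 1 0 ω' u)‖ ≤ 1 * (5 / (ω' ^ 2 + Λ ^ 2)) := by
    rw [norm_mul]; exact mul_le_mul hWe h4 (norm_nonneg _) zero_le_one
  refine (norm_add₃_le).trans ((add_le_add (add_le_add hp1 hp2) hp3).trans (le_of_eq ?_))
  field_simp
  norm_num

/-- **THE UNIFORM GRADIENT BOUND at transfer frequency `Ω`**: `‖∂ᵤN_Ω(e,u)‖ ≤ (6B₁ + 5/2)/Λ` for ALL levels. [cite: BenfattoGiulianiMastropietro2006, §2.4 (2.36)] -/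
theorem norm_ppShiftNumeratorDu_le_unif {β Λ : ℝ} (hβ : 0 < β) (hΛ : 0 < Λ) {B₁ : ℝ} (hB₁ : ∀ x, |deriv salmhoferCutoff x| ≤ B₁) (m : ℤ) (e u : ℝ) :
    ‖ppShiftNumeratorDu β Λ m e u‖ ≤ (6 * B₁ + 5 / 2) / Λ := by
  have hB0 := salmhoferB₁_nonneg hB₁
  unfold ppShiftNumeratorDu
  set f : ℤ → ℂ := fun n => ppShiftSummandDu β Λ m e u n with hf
  set g : ℤ → ℝ := fun n => (12 * B₁ + 5) * (1 / ((ppBose β m - ppFreqZ β n) ^ 2 + Λ ^ 2)) with hg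
  have hbd : ∀ n, ‖f n‖ ≤ g n := fun n => by
    simp only [hf, hg]; rw [← div_eq_mul_one_div]; exact norm_ppShiftSummandDu_le_unif hβ hΛ hB₁ m e u n
  have hsg : Summable g := (summable_one_div_shift_sq_add_sq hβ m Λ).mul_left _
  have hsf : Summable f := Summable.of_norm_bounded hsg hbd
  have hgsum : ∑' n : ℤ, g n = (12 * B₁ + 5) * (β * Real.tanh (β * Λ / 2) / (2 * Λ)) := by
    simp only [hg]
    rw [tsum_mul_left]
    congr 1
    rw [tsum_shift_eq (fun x => 1 / (x ^ 2 + Λ ^ 2)) β m]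
    simpa [ppFreqZ] using tsum_int_one_div_matsubara_sq_add_sq hβ hΛ.ne'
  have htsum : ‖∑' n : ℤ, f n‖ ≤ (12 * B₁ + 5) * (β * Real.tanh (β * Λ / 2) / (2 * Λ)) := by
    rw [← hgsum]; exact tsum_of_norm_bounded hsg.hasSum hbd
  have ht : Real.tanh (β * Λ / 2) ≤ 1 := (Real.tanh_lt_one _).le
  rw [norm_mul, Complex.norm_real, Real.norm_eq_abs, abs_of_pos (by positivity : (0 : ℝ) < 1 / β)]
  calc 1 / β * ‖∑' n : ℤ, f n‖ ≤ 1 / β * ((12 * B₁ + 5) * (β * Real.tanh (β * Λ / 2) / (2 * Λ))) := mul_le_mul_of_nonneg_left htsum (by positivity)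
    _ = (6 * B₁ + 5 / 2) / Λ * Real.tanh (β * Λ / 2) := by field_simp; ring
    _ ≤ (6 * B₁ + 5 / 2) / Λ * 1 := mul_le_mul_of_nonneg_left ht (by positivity)
    _ = (6 * B₁ + 5 / 2) / Λ := mul_one _

/-! ## §2 The value -/

/-- **`‖N_Ω(e,u)‖ ≤ 4‖e+u−iΩ‖/Λ`** (`m ≠ 0`): from the product form and `(1/β)Σ_ℤ 1/(ω²+Λ²) = tanh(βΛ/2)/(2Λ)` on both lattices.
[cite: BenfattoGiulianiMastropietro2006, §2.1 (2.3)] -/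
theorem norm_ppShiftNumerator_le {β Λ : ℝ} (hβ : 0 < β) (hΛ : 0 < Λ) {m : ℤ} (hm : m ≠ 0) (e u : ℝ) :
    ‖ppShiftNumerator β Λ m e u‖ ≤ 4 * ‖(e : ℂ) + u - I * (ppBose β m : ℝ)‖ / Λ := by
  have hs := transferDen_ne_zero hβ hm e u
  unfold ppShiftNumerator
  set Z : ℝ := ‖(e : ℂ) + u - I * (ppBose β m : ℝ)‖ with hZ
  set g : ℤ → ℝ := fun n => 4 * Z * (1 / (ppFreqZ β n ^ 2 + Λ ^ 2) + 1 / ((ppBose β m - ppFreqZ β n) ^ 2 + Λ ^ 2)) with hg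
  have hbd : ∀ n, ‖ppShiftSummand β Λ m e u n‖ ≤ g n := fun n => norm_ppShiftSummand_le hΛ m e u hs n
  have hs1 := summable_one_div_ppFreqZ_sq_add_sq hβ Λ
  have hs2 := summable_one_div_shift_sq_add_sq hβ m Λ
  have hsg : Summable g := (hs1.add hs2).mul_left _
  have hv : ∑' n : ℤ, (1 : ℝ) / (ppFreqZ β n ^ 2 + Λ ^ 2) = β * Real.tanh (β * Λ / 2) / (2 * Λ) := by
    simpa [ppFreqZ] using tsum_int_one_div_matsubara_sq_add_sq hβ hΛ.ne'
  have hv2 : ∑' n : ℤ, (1 : ℝ) / ((ppBose β m - ppFreqZ β n) ^ 2 + Λ ^ 2) = β * Real.tanh (β * Λ / 2) / (2 * Λ) := by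
    rw [tsum_shift_eq (fun x => 1 / (x ^ 2 + Λ ^ 2)) β m]; exact hv
  have hgsum : ∑' n : ℤ, g n = 4 * Z * (2 * (β * Real.tanh (β * Λ / 2) / (2 * Λ))) := by
    simp only [hg]; rw [tsum_mul_left, hs1.tsum_add hs2, hv, hv2]; ring
  have htsum : ‖∑' n : ℤ, ppShiftSummand β Λ m e u n‖ ≤ 4 * Z * (2 * (β * Real.tanh (β * Λ / 2) / (2 * Λ))) := by
    rw [← hgsum]; exact tsum_of_norm_bounded hsg.hasSum hbd
  have ht : Real.tanh (β * Λ / 2) ≤ 1 := (Real.tanh_lt_one _).le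
  have hZ0 : 0 ≤ Z := norm_nonneg _
  rw [norm_mul, Complex.norm_real, Real.norm_eq_abs, abs_of_pos (by positivity : (0 : ℝ) < 1 / β)]
  calc 1 / β * ‖∑' n : ℤ, ppShiftSummand β Λ m e u n‖ ≤ 1 / β * (4 * Z * (2 * (β * Real.tanh (β * Λ / 2) / (2 * Λ)))) :=
        mul_le_mul_of_nonneg_left htsum (by positivity)
    _ = 4 * Z / Λ * Real.tanh (β * Λ / 2) := by field_simp
    _ ≤ 4 * Z / Λ * 1 := mul_le_mul_of_nonneg_left ht (by positivity)
    _ = 4 * Z / Λ := mul_one _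

/-! ## §3 The far region `Λ < u` -/

/-- **`∂ᵤN_Ω` on the far region**: `Λ < u ⟹ ∂ᵤN_Ω(e,u) = (1/β)Σ_{n∈ℤ} W(ωₙ,e)·r′(Ω−ωₙ,u)`. [cite: BenfattoGiulianiMastropietro2006, §2.4 (2.36)] -/
theorem ppShiftNumeratorDu_of_far {β Λ u : ℝ} (hΛ : 0 < Λ) (hu : Λ < u) (m : ℤ) (e : ℝ) :
    ppShiftNumeratorDu β Λ m e u = ((1 / β : ℝ) : ℂ) * ∑' n : ℤ, ((uvWeightFn Λ (ppFreqZ β n) e : ℝ) : ℂ) * resolventFnXiD1 1 0 (ppBose β m - ppFreqZ β n) u := by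
  unfold ppShiftNumeratorDu
  congr 1
  refine tsum_congr fun n => ?_
  have h : Λ ^ 2 < u ^ 2 + (ppBose β m - ppFreqZ β n) ^ 2 := by nlinarith [sq_nonneg (ppBose β m - ppFreqZ β n), mul_pos hΛ (hΛ.trans hu)]
  obtain ⟨h1, h2, -⟩ := uvWeightFn_eq_one_of_gt hΛ h
  unfold ppShiftSummandDu
  rw [h1, h2]; push_cast; ring

/-- The resolvent derivative in real coordinates: `r′(ω,u) = −1/(−iω+u)² = ((ω²−u²) − 2iuω)/(ω²+u²)²`. [folklore] -/
theorem resolventFnXiD1_eq_div (ω u : ℝ) (h : ω ^ 2 + u ^ 2 ≠ 0) :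
    resolventFnXiD1 1 0 ω u = ((((ω ^ 2 - u ^ 2 : ℝ) : ℂ) - I * ((2 * u * ω : ℝ) : ℂ))) / (((ω ^ 2 + u ^ 2) ^ 2 : ℝ) : ℂ) := by
  have hden : (-I * ((ω + 0 : ℝ) : ℂ) + (u : ℂ)) ≠ 0 := by
    intro h0
    have := norm_sq_uvDen u ω
    rw [h0, norm_zero] at this
    exact h (by nlinarith [this])
  unfold resolventFnXiD1
  have hd2 : (-I * ((ω + 0 : ℝ) : ℂ) + (u : ℂ)) ^ 2 ≠ 0 := pow_ne_zero 2 hden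
  have hq : (((ω ^ 2 + u ^ 2) ^ 2 : ℝ) : ℂ) ≠ 0 := by exact_mod_cast pow_ne_zero 2 h
  rw [div_eq_div_iff hd2 hq]
  push_cast
  ring_nf
  rw [Complex.I_sq, I_pow_three]
  ring

/-- The same in separated form: `r′(ω,u) = Re − i·Im` with `Re = (ω²−u²)/(ω²+u²)²`, `Im = 2uω/(ω²+u²)²`. [folklore] -/
theorem resolventFnXiD1_eq_re_im {ω u : ℝ} (h : ω ^ 2 + u ^ 2 ≠ 0) :
    resolventFnXiD1 1 0 ω u = (((ω ^ 2 - u ^ 2) / (ω ^ 2 + u ^ 2) ^ 2 : ℝ) : ℂ) - I * (((2 * u * ω) / (ω ^ 2 + u ^ 2) ^ 2 : ℝ) : ℂ) := by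
  have hq : (((ω ^ 2 + u ^ 2) ^ 2 : ℝ) : ℂ) ≠ 0 := by exact_mod_cast pow_ne_zero 2 h
  rw [resolventFnXiD1_eq_div ω u h]
  push_cast
  field_simp

/-- **The full-orbit cancellation at any transfer frequency**: `(1/β)·Σ_{n∈ℤ} r′(ωₙ,u) = (β/4)·sech²(βu/2)` (`u ≠ 0`): the real parts are the two-sided
Lorentzian-derivative sum, the imaginary parts are odd in `ωₙ` and cancel. [cite: BenfattoGiulianiMastropietro2006, §2.1 (2.2)-(2.5)] -/
theorem tsum_int_resolventD1_eq {β : ℝ} (hβ : 0 < β) {u : ℝ} (hu : u ≠ 0) :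
    ((1 / β : ℝ) : ℂ) * ∑' n : ℤ, resolventFnXiD1 1 0 (ppFreqZ β n) u = ((β / 4 * sech (β * u / 2) ^ 2 : ℝ) : ℂ) := by
  have hne : ∀ n : ℤ, ppFreqZ β n ^ 2 + u ^ 2 ≠ 0 := fun n => by have := ppFreqZ_ne_zero hβ n; positivity
  set re : ℤ → ℝ := fun n => (ppFreqZ β n ^ 2 - u ^ 2) / (ppFreqZ β n ^ 2 + u ^ 2) ^ 2 with hre
  set im : ℤ → ℝ := fun n => (2 * u * ppFreqZ β n) / (ppFreqZ β n ^ 2 + u ^ 2) ^ 2 with him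
  have hterm : ∀ n : ℤ, resolventFnXiD1 1 0 (ppFreqZ β n) u = ((re n : ℝ) : ℂ) - I * ((im n : ℝ) : ℂ) := fun n => resolventFnXiD1_eq_re_im (hne n)
  -- summability of both parts
  have hsre : Summable re := by
    have h := summable_int_matsubara_lorentzian_deriv hβ u
    simpa [hre, ppFreqZ] using h
  have himb : ∀ n : ℤ, |im n| ≤ 1 / (ppFreqZ β n ^ 2 + 0 ^ 2) := fun n => by
    have hω := ppFreqZ_ne_zero hβ n
    have hpos : 0 < ppFreqZ β n ^ 2 + u ^ 2 := by positivity
    simp only [him]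
    rw [zero_pow two_ne_zero, add_zero, abs_div, abs_of_pos (pow_pos hpos 2), div_le_div_iff₀ (pow_pos hpos 2) (by positivity), one_mul]
    have h1 : |2 * u * ppFreqZ β n| ≤ ppFreqZ β n ^ 2 + u ^ 2 := by
      rw [abs_le]; constructor <;> nlinarith [sq_nonneg (u - ppFreqZ β n), sq_nonneg (u + ppFreqZ β n)]
    calc |2 * u * ppFreqZ β n| * ppFreqZ β n ^ 2 ≤ (ppFreqZ β n ^ 2 + u ^ 2) * (ppFreqZ β n ^ 2 + u ^ 2) :=
          mul_le_mul h1 (by nlinarith [sq_nonneg u]) (by positivity) hpos.le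
      _ = (ppFreqZ β n ^ 2 + u ^ 2) ^ 2 := by ring
  have hsim : Summable im := Summable.of_norm_bounded (summable_one_div_ppFreqZ_sq_add_sq hβ 0) fun n => by
    rw [Real.norm_eq_abs]; exact himb n
  -- the imaginary part is odd: `im(−n−1) = −im(n)` since `ω_{−n−1} = −ωₙ`; its two-sided sum vanishes
  have hfreq : ∀ n : ℕ, ppFreqZ β (-(n + 1 : ℕ) : ℤ) = -ppFreqZ β (n : ℤ) := fun n => by
    unfold ppFreqZ; push_cast; ring
  have hodd : ∀ n : ℕ, im (-(n + 1 : ℕ) : ℤ) = -im (n : ℤ) := fun n => by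
    simp only [him]
    rw [hfreq n]
    ring
  have him1 : Summable fun n : ℕ => im n := hsim.comp_injective Nat.cast_injective
  have him2 : Summable fun n : ℕ => im (-(n + 1)) := by
    have : (fun n : ℕ => im (-(n + 1))) = fun n : ℕ => -im n := by
      funext n; have h := hodd n; push_cast at h ⊢; exact h
    rw [this]; exact him1.neg
  have himsum : ∑' n : ℤ, im n = 0 := by
    rw [tsum_of_nat_of_neg_add_one him1 him2]
    have : (fun n : ℕ => im (-(n + 1))) = fun n : ℕ => -im n := by
      funext n; have h := hodd n; push_cast at h ⊢; exact h
    rw [this, tsum_neg]; ring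
  have hresum : ∑' n : ℤ, re n = β ^ 2 / 4 * sech (β * u / 2) ^ 2 := by
    have h := tsum_int_matsubara_lorentzian_deriv hβ u
    simpa [hre, ppFreqZ] using h
  -- assemble
  have hsreC : Summable fun n : ℤ => ((re n : ℝ) : ℂ) := Complex.summable_ofReal.2 hsre
  have hsimC : Summable fun n : ℤ => ((im n : ℝ) : ℂ) := Complex.summable_ofReal.2 hsim
  rw [tsum_congr hterm, hsreC.tsum_sub (hsimC.mul_left I), tsum_mul_left, ← Complex.ofReal_tsum, ← Complex.ofReal_tsum, hresum, himsum]
  have hβC : (β : ℂ) ≠ 0 := by exact_mod_cast hβ.ne'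
  push_cast
  field_simp
  ring

/-- **`‖∂ᵤN_Ω(e,u) − (β/4)sech²(βu/2)‖ ≤ Λ/u²` on the far region `Λ < u`, for EVERY loop level `e`** (defect `1 − W(ωₙ,e)` shell-majorised, `‖r′‖ ≤ 1/u²`,
full orbit re-indexed by the bosonic shift). [cite: BenfattoGiulianiMastropietro2006, §2.4 (2.36)] -/
theorem norm_ppShiftNumeratorDu_far_sub_le {β Λ u : ℝ} (hβ : 0 < β) (hΛ : 0 < Λ) (hu : Λ < u) (m : ℤ) (e : ℝ) :
    ‖ppShiftNumeratorDu β Λ m e u - ((β / 4 * sech (β * u / 2) ^ 2 : ℝ) : ℂ)‖ ≤ Λ / u ^ 2 := by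
  have hu0 : 0 < u := hΛ.trans hu
  rw [ppShiftNumeratorDu_of_far hΛ hu m e]
  -- the main part: full orbit, shifted lattice
  have hmain : ((1 / β : ℝ) : ℂ) * ∑' n : ℤ, resolventFnXiD1 1 0 (ppBose β m - ppFreqZ β n) u = ((β / 4 * sech (β * u / 2) ^ 2 : ℝ) : ℂ) := by
    rw [tsum_shift_eq (fun x => resolventFnXiD1 1 0 x u) β m]; exact tsum_int_resolventD1_eq hβ hu0.ne'
  -- summability
  have hne : ∀ n : ℤ, ppBose β m - ppFreqZ β n ≠ 0 := fun n => by rw [ppBose_sub_ppFreqZ]; exact ppFreqZ_ne_zero hβ _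
  have hD1b : ∀ n : ℤ, ‖resolventFnXiD1 1 0 (ppBose β m - ppFreqZ β n) u‖ ≤ 1 / ((ppBose β m - ppFreqZ β n) ^ 2 + 0 ^ 2) := fun n => by
    rw [zero_pow two_ne_zero, add_zero]; exact norm_resolventFnXiD1_le_inv_sq (hne n) u
  have hsD1 : Summable fun n : ℤ => resolventFnXiD1 1 0 (ppBose β m - ppFreqZ β n) u :=
    Summable.of_norm_bounded (summable_one_div_shift_sq_add_sq hβ m 0) hD1b
  have hWb : ∀ n : ℤ, ‖((uvWeightFn Λ (ppFreqZ β n) e : ℝ) : ℂ) * resolventFnXiD1 1 0 (ppBose β m - ppFreqZ β n) u‖ ≤ 1 / ((ppBose β m - ppFreqZ β n) ^ 2 + 0 ^ 2) :=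
    fun n => by
      rw [norm_mul, Complex.norm_real, Real.norm_eq_abs]
      calc |uvWeightFn Λ (ppFreqZ β n) e| * ‖resolventFnXiD1 1 0 (ppBose β m - ppFreqZ β n) u‖ ≤ 1 * (1 / ((ppBose β m - ppFreqZ β n) ^ 2 + 0 ^ 2)) :=
            mul_le_mul (abs_uvWeightFn_le_one _ _ _) (hD1b n) (norm_nonneg _) zero_le_one
        _ = _ := one_mul _
  have hsW : Summable fun n : ℤ => ((uvWeightFn Λ (ppFreqZ β n) e : ℝ) : ℂ) * resolventFnXiD1 1 0 (ppBose β m - ppFreqZ β n) u :=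
    Summable.of_norm_bounded (summable_one_div_shift_sq_add_sq hβ m 0) hWb
  -- defect terms
  have hr2 : ∀ n : ℤ, ‖resolventFnXiD1 1 0 (ppBose β m - ppFreqZ β n) u‖ ≤ 1 / u ^ 2 := fun n => by
    rw [norm_resolventFnXiD1 zero_le_one]
    have hre : |u| ≤ ‖-I * ((ppBose β m - ppFreqZ β n + 0 : ℝ) : ℂ) + (u : ℂ)‖ := by
      have h1 := Complex.abs_re_le_norm (-I * ((ppBose β m - ppFreqZ β n + 0 : ℝ) : ℂ) + (u : ℂ)); simpa using h1
    have h2 : u ^ 2 ≤ ‖-I * ((ppBose β m - ppFreqZ β n + 0 : ℝ) : ℂ) + (u : ℂ)‖ ^ 2 := by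
      rw [← sq_abs u]; exact pow_le_pow_left₀ (abs_nonneg _) hre 2
    exact div_le_div_of_nonneg_left zero_le_one (by positivity) h2
  have hdef : ∀ n : ℤ, ‖(((uvWeightFn Λ (ppFreqZ β n) e : ℝ) : ℂ) - 1) * resolventFnXiD1 1 0 (ppBose β m - ppFreqZ β n) u‖ ≤
      2 * Λ ^ 2 / (ppFreqZ β n ^ 2 + Λ ^ 2) * (1 / u ^ 2) := fun n => by
    obtain ⟨h0, h1⟩ := one_sub_uvWeightFn_le_shell hΛ (ppFreqZ β n) e
    rw [norm_mul, show (((uvWeightFn Λ (ppFreqZ β n) e : ℝ) : ℂ) - 1) = (((uvWeightFn Λ (ppFreqZ β n) e - 1 : ℝ)) : ℂ) by push_cast; ring,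
      Complex.norm_real, Real.norm_eq_abs, abs_sub_comm, abs_of_nonneg h0]
    exact mul_le_mul h1 (hr2 n) (norm_nonneg _) (by positivity)
  have hsdef : Summable fun n : ℤ => (((uvWeightFn Λ (ppFreqZ β n) e : ℝ) : ℂ) - 1) * resolventFnXiD1 1 0 (ppBose β m - ppFreqZ β n) u :=
    Summable.of_norm_bounded (((summable_one_div_ppFreqZ_sq_add_sq hβ Λ).mul_left (2 * Λ ^ 2)).mul_right (1 / u ^ 2) |>.congr (fun n => by field_simp)) hdef
  -- split W = 1 + (W − 1)
  have hsplit : ∑' n : ℤ, ((uvWeightFn Λ (ppFreqZ β n) e : ℝ) : ℂ) * resolventFnXiD1 1 0 (ppBose β m - ppFreqZ β n) u =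
      (∑' n : ℤ, resolventFnXiD1 1 0 (ppBose β m - ppFreqZ β n) u) +
        ∑' n : ℤ, (((uvWeightFn Λ (ppFreqZ β n) e : ℝ) : ℂ) - 1) * resolventFnXiD1 1 0 (ppBose β m - ppFreqZ β n) u := by
    rw [← hsD1.tsum_add hsdef]; exact tsum_congr fun n => by ring
  rw [hsplit, mul_add, hmain, add_sub_cancel_left, norm_mul, Complex.norm_real, Real.norm_eq_abs, abs_of_pos (by positivity : (0 : ℝ) < 1 / β)]
  have hshell : ∑' n : ℤ, 2 * Λ ^ 2 / (ppFreqZ β n ^ 2 + Λ ^ 2) * (1 / u ^ 2) = 2 * Λ ^ 2 * (β * Real.tanh (β * Λ / 2) / (2 * Λ)) * (1 / u ^ 2) := by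
    rw [tsum_mul_right]
    congr 1
    have hv : ∑' n : ℤ, (1 : ℝ) / (ppFreqZ β n ^ 2 + Λ ^ 2) = β * Real.tanh (β * Λ / 2) / (2 * Λ) := by
      simpa [ppFreqZ] using tsum_int_one_div_matsubara_sq_add_sq hβ hΛ.ne'
    rw [← hv, ← tsum_mul_left]; exact tsum_congr fun n => by field_simp
  have htsum : ‖∑' n : ℤ, (((uvWeightFn Λ (ppFreqZ β n) e : ℝ) : ℂ) - 1) * resolventFnXiD1 1 0 (ppBose β m - ppFreqZ β n) u‖ ≤
      2 * Λ ^ 2 * (β * Real.tanh (β * Λ / 2) / (2 * Λ)) * (1 / u ^ 2) := by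
    rw [← hshell]
    exact tsum_of_norm_bounded ((((summable_one_div_ppFreqZ_sq_add_sq hβ Λ).mul_left (2 * Λ ^ 2)).mul_right (1 / u ^ 2) |>.congr
      (fun n => by field_simp))).hasSum hdef
  have ht : Real.tanh (β * Λ / 2) ≤ 1 := (Real.tanh_lt_one _).le
  calc 1 / β * ‖∑' n : ℤ, (((uvWeightFn Λ (ppFreqZ β n) e : ℝ) : ℂ) - 1) * resolventFnXiD1 1 0 (ppBose β m - ppFreqZ β n) u‖
      ≤ 1 / β * (2 * Λ ^ 2 * (β * Real.tanh (β * Λ / 2) / (2 * Λ)) * (1 / u ^ 2)) := mul_le_mul_of_nonneg_left htsum (by positivity)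
    _ = Λ / u ^ 2 * Real.tanh (β * Λ / 2) := by field_simp
    _ ≤ Λ / u ^ 2 * 1 := mul_le_mul_of_nonneg_left ht (by positivity)
    _ = Λ / u ^ 2 := mul_one _

end Summit.HubbardSuperconductivity.HubbardSuperconductivity.Theorems.C4a

end
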